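import Summits.AtomisticToContinuum.HydrodynamicLimit.Theorems.TwoClocksEquilibriumFastWindowLDBirthT12FarFieldContraction
import Summits.AtomisticToContinuum.HydrodynamicLimit.Theorems.TwoClocksEquilibriumFastWindowLDBirthT12LegendreCertificate
import Summits.AtomisticToContinuum.HydrodynamicLimit.Theorems.TwoClocksEquilibriumFastWindowLDBirthT12LegendreMoments
import HarnessLib

/-!
# Iterated zonal operators on `S²`, II: the sup-norm contraction on the sector `ℓ ≥ 2` from the Legendre
# multipliers, and the eight-step far-field contraction by `2/3`
# (helpers `t12_iterate_zonal_contraction_sup`, `t12_farField_contraction_sup` of the line `birth`, crux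
# `TwoClocks.EquilibriumFastWindowLD`, stmt-AtomisticToContinuum-14440; the §6 FF2/FF3/FF4 junction of the
# registered analytic sub-goal `t12_logLinearPreimage_and_dipoleModulus`)

For a zonal operator `(K F)(x) = ∫_{S²} k(⟪x, ω⟫) F(ω) dσ(ω)` (`σ = volume.toSphere`, mass `4π`; `k` measurable,
`|k| ≤ M` on `[-1, 1]`) with Funk–Hecke multipliers `λ_ℓ = 2π ∫_{-1}^{1} k P_ℓ` (`t12_funkHecke_legendre`):

* `abs_zonalOp_le_integral_abs`, `integral_abs_iterate_zonalOp_le` — `|K G| ≤ M ‖G‖_{L¹(S²)}` on the sphere,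
  hence `‖K^i G‖_{L¹(S²)} ≤ (4πM)^i ‖G‖_{L¹(S²)}`;
* **`abs_iterate_zonalOp_le_of_orthogonal`** (registered `t12_iterate_zonal_contraction_sup`) — if
  `Σ_{ℓ=2}^{N+1} (2ℓ+1)/2 ‖P_ℓ‖_{L¹[-1,1]} |λ_ℓ|^j ≤ θ` for all `N` (`j ≥ 1`), then for every bounded measurable
  profile `Y` (`|Y| ≤ m` on the unit sphere) with ZERO ZONAL AVERAGE and ZERO DIPOLE MOMENT,
  `|(K^j Y)(n)| ≤ θ m` at every unit `n`: `θ_j := ‖K^j‖_{L^∞→L^∞, ℓ≥2} ≤ Σ_{ℓ≥2} c_ℓ |λ_ℓ|^j`,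
  `c_ℓ = (2ℓ+1)/2 ‖P_ℓ‖₁` — the plan's "`θ_k ≤ Σ_{ℓ≥2} (2ℓ+1)/2 ‖P_ℓ‖₁ Π|P_ℓ(ρ_i)|`". Proof (no kernel of `K^j` is
  formed): symmetry `(K^j Y)(n) = ∫ (K^{j-1} κ_n) Y dσ`, `κ_n = k(⟪n, ·⟫)` (sibling file I); Legendre series
  `κ_n = Σ_{ℓ<L} a_ℓ P_ℓ(⟪n, ·⟫) + r_L(⟪n, ·⟫)`, `a_ℓ = (2ℓ+1)/2 ∫ k P_ℓ = (2ℓ+1)/(4π) λ_ℓ`, `‖r_L‖_{L¹[-1,1]} → 0`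
  (`t12_legendre_series_L1`); `K^{j-1} P_ℓ(⟪n, ·⟫) = λ_ℓ^{j-1} P_ℓ(⟪n, ·⟫)` (`t12_iterate_zonal_legendre`) and
  `‖K^{j-1} r_L(⟪n, ·⟫)‖_{L¹(S²)} ≤ (4πM)^{j-1} 2π ‖r_L‖₁ → 0`; pairing with `Y` kills `ℓ = 0, 1`
  (`∫ Y = 0`, `∫ ⟪n, ω⟫ Y = 0`) and `|∫ P_ℓ(⟪n, ·⟫) Y| ≤ m · 2π‖P_ℓ‖₁` (duality, as in `t12_angularContraction`),
  so `|(K^j Y)(n)| ≤ m (o(1) + Σ_{ℓ=2}^{L-1} (2ℓ+1)/2 · |λ_ℓ|/(2π) · |λ_ℓ|^{j-1} · 2π‖P_ℓ‖₁) ≤ m (o(1) + θ)`.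
* **`t12_farField_contraction_sup`** (registered) and `farField_contraction_sup_six` — the NORMALISED
  FAR-FIELD STEP `k = (2/π) x₊²`: `|(T⁸ Y)(n)| ≤ (2/3) m`, `|(T⁶ Y)(n)| ≤ (1/2) m` on the sector `ℓ ≥ 2`, from
  `|λ_ℓ| ≤ μ_ℓ = 4∫₀¹ρ²|P_ℓ|` (`abs_farFieldStep_legendreCoeff_le`) and the certificates
  `Σ c_ℓ μ_ℓ⁸ ≤ 2/3` (`t12_farField_legendreCertificate`), `Σ c_ℓ μ_ℓ⁶ ≤ 1/2` (`farField_legendreCertificate_six`).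

NORMALISATION CHECK. `T` is the operator with kernel `(2/π)⟪x, ω⟫₊²` against `σ` of mass `4π`; its
multipliers are `λ_ℓ = 2π∫_{-1}^{1}(2/π)z₊²P_ℓ = 4∫₀¹ z² P_ℓ = 4/3, 1, 8/15, 1/6, 0, -1/48, …` (`farFieldStep_legendreCoeff`)
= the plan's `λ_ℓ(1)` of the normalised step `ν⁻¹K₂^∞` on the linear-growth class (`…T12Indicial`), and
`lorentzGain u (s n) = πs · s · (T Y)(n)` for `u(r x) = r Y(x)` (`lorentzGain_smul_of_linear_eq_farFieldStep`).
So `T` IS the plan's normalised step and `θ₈(T) ≤ 2/3`, `θ₆(T) ≤ 1/2` carry no further normalisation factor.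
All statements are [folklore] (Funk 1916 / Hecke 1918; duality `L^∞ → L^∞` for zonal kernels).
-/

noncomputable section

open MeasureTheory Real Set Filter Metric Polynomial Topology
open scoped ENNReal BigOperators InnerProductSpace
namespace Summit.AtomisticToContinuum.HydrodynamicLimit.Theorems.ClampedCorrectorBirth

open Literature.Analysis.FluidPDE Literature.MathematicalPhysics.KineticTheory
  Literature.Analysis.SpecialFunctions

/-! ### `L¹(S²)` bounds of the iterates -/

section ZonalOp

variable {k : ℝ → ℝ} {M : ℝ} {K : (EuclideanSpace ℝ (Fin 3) → ℝ) → EuclideanSpace ℝ (Fin 3) → ℝ}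
  (hK : K = fun (F : EuclideanSpace ℝ (Fin 3) → ℝ) (x : EuclideanSpace ℝ (Fin 3)) =>
    ∫ ω : sphere (0 : EuclideanSpace ℝ (Fin 3)) 1, k ⟪x, (ω : EuclideanSpace ℝ (Fin 3))⟫_ℝ * F ω ∂sphereMeasure)
include hK

/-- **`L¹ → sup` bound of one step**: `|K G(x)| ≤ M ∫ |G| dσ` for unit `x` (`|k| ≤ M` on `[-1, 1]`).
[folklore] -/
theorem abs_zonalOp_le_integral_abs (hM : ∀ t ∈ Icc (-1:ℝ) 1, |k t| ≤ M)
    {G : EuclideanSpace ℝ (Fin 3) → ℝ} (hG : Measurable G) {mG : ℝ}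
    (hmG : ∀ x : EuclideanSpace ℝ (Fin 3), ‖x‖ = 1 → |G x| ≤ mG) {x : EuclideanSpace ℝ (Fin 3)} (hx : ‖x‖ = 1) :
    |K G x| ≤ M * ∫ ω : sphere (0 : EuclideanSpace ℝ (Fin 3)) 1, |G ω| ∂sphereMeasure := by
  subst hK
  calc |∫ ω : sphere (0 : EuclideanSpace ℝ (Fin 3)) 1, k ⟪x, (ω : EuclideanSpace ℝ (Fin 3))⟫_ℝ * G ω ∂sphereMeasure|
      ≤ ∫ ω : sphere (0 : EuclideanSpace ℝ (Fin 3)) 1, |k ⟪x, (ω : EuclideanSpace ℝ (Fin 3))⟫_ℝ * G ω| ∂sphereMeasure :=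
        abs_integral_le_integral_abs
    _ ≤ ∫ ω : sphere (0 : EuclideanSpace ℝ (Fin 3)) 1, M * |G ω| ∂sphereMeasure := by
        refine integral_mono_of_nonneg (Eventually.of_forall fun ω => abs_nonneg _)
          ((integrable_sphere_of_abs_le hG hmG).abs.const_mul M) (Eventually.of_forall fun ω => ?_)
        dsimp only
        rw [abs_mul]
        exact mul_le_mul_of_nonneg_right (hM _ (inner_mem_Icc_of_norm_eq_one hx (by simp))) (abs_nonneg _)
    _ = M * ∫ ω : sphere (0 : EuclideanSpace ℝ (Fin 3)) 1, |G ω| ∂sphereMeasure := integral_const_mul _ _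

/-- **`L¹(S²)` bound of the iterates**: `∫ |K^i G| dσ ≤ (4π M)^i ∫ |G| dσ`. [folklore] -/
theorem integral_abs_iterate_zonalOp_le (hk : Measurable k) (hM : ∀ t ∈ Icc (-1:ℝ) 1, |k t| ≤ M) (i : ℕ) :
    ∀ {G : EuclideanSpace ℝ (Fin 3) → ℝ}, Measurable G → ∀ {mG : ℝ},
      (∀ x : EuclideanSpace ℝ (Fin 3), ‖x‖ = 1 → |G x| ≤ mG) →
      ∫ ω : sphere (0 : EuclideanSpace ℝ (Fin 3)) 1, |(K^[i] G) ω| ∂sphereMeasure ≤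
        (4 * π * M) ^ i * ∫ ω : sphere (0 : EuclideanSpace ℝ (Fin 3)) 1, |G ω| ∂sphereMeasure := by
  haveI := isFiniteMeasure_sphereMeasure (E := EuclideanSpace ℝ (Fin 3))
  have hkI := intervalIntegrable_of_abs_le_on_Icc hk hM
  have hM0 : 0 ≤ M := (abs_nonneg _).trans (hM 0 (by norm_num))
  induction i with
  | zero => intros; simp
  | succ i ih =>
    intro G hG mG hmG
    have hKiG : Measurable (K^[i] G) := by subst hK; exact measurable_iterate_sphere_zonal hk hG i
    have hbKiG : ∀ x : EuclideanSpace ℝ (Fin 3), ‖x‖ = 1 →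
        |(K^[i] G) x| ≤ (2 * π * ∫ t in (-1:ℝ)..1, |k t|) ^ i * mG := by
      subst hK; exact abs_iterate_sphere_zonal_le hkI hmG i
    rw [Function.iterate_succ_apply']
    calc ∫ ω : sphere (0 : EuclideanSpace ℝ (Fin 3)) 1, |K (K^[i] G) ω| ∂sphereMeasure
        ≤ ∫ _ω : sphere (0 : EuclideanSpace ℝ (Fin 3)) 1,
            M * ∫ ω' : sphere (0 : EuclideanSpace ℝ (Fin 3)) 1, |(K^[i] G) ω'| ∂sphereMeasure ∂sphereMeasure :=
          integral_mono_of_nonneg (Eventually.of_forall fun ω => abs_nonneg _) (integrable_const _)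
            (Eventually.of_forall fun ω => abs_zonalOp_le_integral_abs hK hM hKiG hbKiG (by simp))
      _ = 4 * π * M * ∫ ω' : sphere (0 : EuclideanSpace ℝ (Fin 3)) 1, |(K^[i] G) ω'| ∂sphereMeasure := by
          rw [integral_const, smul_eq_mul, sphereMeasure_real_univ_fin3]; ring
      _ ≤ 4 * π * M * ((4 * π * M) ^ i * ∫ ω : sphere (0 : EuclideanSpace ℝ (Fin 3)) 1, |G ω| ∂sphereMeasure) :=
          mul_le_mul_of_nonneg_left (ih hG hmG) (by positivity)
      _ = _ := by ring

end ZonalOp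

/-! ### The sup-norm contraction on the sector `ℓ ≥ 2` -/

section Contraction

variable {k : ℝ → ℝ} {M : ℝ} {K : (EuclideanSpace ℝ (Fin 3) → ℝ) → EuclideanSpace ℝ (Fin 3) → ℝ}
  (hK : K = fun (F : EuclideanSpace ℝ (Fin 3) → ℝ) (x : EuclideanSpace ℝ (Fin 3)) =>
    ∫ ω : sphere (0 : EuclideanSpace ℝ (Fin 3)) 1, k ⟪x, (ω : EuclideanSpace ℝ (Fin 3))⟫_ℝ * F ω ∂sphereMeasure)
include hK

/-- **Sup-norm contraction of the iterated zonal operator on the sector `ℓ ≥ 2`.** For a measurable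
weight `k` with `|k| ≤ M` on `[-1, 1]`, `j ≥ 1`, and a bounded measurable profile `Y` (`|Y| ≤ m` on the
unit sphere) with zero zonal average and zero dipole moment:
`|(K^j Y)(n)| ≤ θ m` as soon as `Σ_{ℓ ≥ 2} (2ℓ+1)/2 ‖P_ℓ‖_{L¹[-1,1]} |λ_ℓ|^j ≤ θ` (all partial sums),
`λ_ℓ = 2π ∫_{-1}^{1} k P_ℓ` the Legendre coefficients (Funk–Hecke multipliers) of `k`. Proof: by symmetry
`(K^j Y)(n) = ∫ (K^{j-1} k(⟪n, ·⟫)) Y dσ`; expand `k = Σ_{ℓ<L} (2ℓ+1)/2 (∫ k P_ℓ) P_ℓ + r_L` with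
`‖r_L‖_{L¹[-1,1]} → 0` (Legendre completeness); `K^{j-1}` acts on `P_ℓ(⟪n, ·⟫)` by `λ_ℓ^{j-1}`
(`iterate_sphere_zonal_legendre`) and has `L¹(S²)` norm `≤ (4πM)^{j-1}`; the modes `ℓ = 0, 1` are
annihilated by `Y`, the others are bounded by duality `|∫ P_ℓ(⟪n, ·⟫) Y| ≤ m · 2π‖P_ℓ‖₁`. [folklore] -/
theorem abs_iterate_zonalOp_le_of_orthogonal (hk : Measurable k) (hM : ∀ t ∈ Icc (-1:ℝ) 1, |k t| ≤ M)
    {j : ℕ} (hj : 0 < j) {θ : ℝ}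
    (hθ : ∀ N : ℕ, ∑ l ∈ Finset.range N, (2 * ((l + 2 : ℕ) : ℝ) + 1) / 2 *
      (∫ x in (-1:ℝ)..1, |(legendre (l + 2)).eval x|) *
      |2 * π * ∫ z in (-1:ℝ)..1, k z * (legendre (l + 2)).eval z| ^ j ≤ θ)
    {Y : EuclideanSpace ℝ (Fin 3) → ℝ} (hY : Measurable Y) {m : ℝ}
    (hm : ∀ x : EuclideanSpace ℝ (Fin 3), ‖x‖ = 1 → |Y x| ≤ m)
    (h0 : ∫ ω : sphere (0 : EuclideanSpace ℝ (Fin 3)) 1, Y ω ∂sphereMeasure = 0)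
    (h1 : ∫ ω : sphere (0 : EuclideanSpace ℝ (Fin 3)) 1, Y ω • (ω : EuclideanSpace ℝ (Fin 3)) ∂sphereMeasure = 0)
    {n : EuclideanSpace ℝ (Fin 3)} (hn : ‖n‖ = 1) : |(K^[j] Y) n| ≤ θ * m := by
  obtain ⟨i, rfl⟩ : ∃ i, j = i + 1 := ⟨j - 1, by omega⟩
  haveI := isFiniteMeasure_sphereMeasure (E := EuclideanSpace ℝ (Fin 3))
  have hkI := intervalIntegrable_of_abs_le_on_Icc hk hM
  have hm0 : 0 ≤ m := (abs_nonneg _).trans (hm n hn)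
  have hM0 : 0 ≤ M := (abs_nonneg _).trans (hM 0 (by norm_num))
  -- notation: Legendre coefficients, the pole function, the partial sums and the remainders
  set lam : ℕ → ℝ := fun l => 2 * π * ∫ z in (-1:ℝ)..1, k z * (legendre l).eval z with hlam
  set a : ℕ → ℝ := fun l => (2 * (l : ℝ) + 1) / 2 * ∫ z in (-1:ℝ)..1, k z * (legendre l).eval z with ha
  set I : ℕ → ℝ := fun L => ∫ t in (-1:ℝ)..1,
    |k t - ∑ l ∈ Finset.range L, (2 * (l : ℝ) + 1) / 2 * (∫ z in (-1:ℝ)..1, k z * (legendre l).eval z) *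
      (legendre l).eval t| with hI
  have hIt : Tendsto I atTop (𝓝 0) := tendsto_integral_abs_sub_legendreSum hk hM
  set κ : EuclideanSpace ℝ (Fin 3) → ℝ := fun y => k ⟪n, y⟫_ℝ with hκ
  set S : ℕ → EuclideanSpace ℝ (Fin 3) → ℝ := fun L y =>
    ∑ l ∈ Finset.range L, a l * (legendre l).eval ⟪n, y⟫_ℝ with hS
  set ρ : ℕ → EuclideanSpace ℝ (Fin 3) → ℝ := fun L y =>
    k ⟪n, y⟫_ℝ - ∑ l ∈ Finset.range L, a l * (legendre l).eval ⟪n, y⟫_ℝ with hρ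
  -- measurability and bounds on the unit sphere
  have hκm : Measurable κ := hk.comp (measurable_const.inner measurable_id)
  have hκb : ∀ x : EuclideanSpace ℝ (Fin 3), ‖x‖ = 1 → |κ x| ≤ M := fun x hx =>
    hM _ (inner_mem_Icc_of_norm_eq_one hn hx)
  have hSc : ∀ L, Continuous fun t : ℝ => ∑ l ∈ Finset.range L, a l * (legendre l).eval t := fun L =>
    continuous_finsetSum _ fun l _ => continuous_const.mul (legendre l).continuous
  have hSm : ∀ L, Measurable (S L) := fun L => (hSc L).measurable.comp (measurable_const.inner measurable_id)
  have hρm : ∀ L, Measurable (ρ L) := fun L => hκm.sub (hSm L)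
  have hρb : ∀ L, ∃ C, ∀ x : EuclideanSpace ℝ (Fin 3), ‖x‖ = 1 → |ρ L x| ≤ C := by
    intro L
    obtain ⟨C, hC⟩ := exists_bound_comp_inner_sphere (hSc L) hn
    exact ⟨M + C, fun x hx => (abs_sub _ _).trans (add_le_add (hκb x hx) (hC x hx))⟩
  have hKρm : ∀ L, Measurable (K^[i] (ρ L)) := fun L => by
    subst hK; exact measurable_iterate_sphere_zonal hk (hρm L) i
  have hKρb : ∀ L, ∃ C, ∀ x : EuclideanSpace ℝ (Fin 3), ‖x‖ = 1 → |(K^[i] (ρ L)) x| ≤ C := by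
    intro L
    obtain ⟨C, hC⟩ := hρb L
    exact ⟨(2 * π * ∫ t in (-1:ℝ)..1, |k t|) ^ i * C, by subst hK; exact abs_iterate_sphere_zonal_le hkI hC i⟩
  -- Step 1: symmetry moves the iterate onto the pole function
  have step1 : (K^[i + 1] Y) n =
      ∫ ω : sphere (0 : EuclideanSpace ℝ (Fin 3)) 1, (K^[i] κ) ω * Y ω ∂sphereMeasure := by
    rw [integral_sphere_iterate_zonalOp_mul_comm hK hk hM i hκm hY hκb hm, Function.iterate_succ_apply']
    subst hK
    rfl
  -- Step 2: `K^i κ` along the Legendre partial sums, on the sphere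
  have step2 : ∀ (L : ℕ) (ω : sphere (0 : EuclideanSpace ℝ (Fin 3)) 1), (K^[i] κ) ω =
      (K^[i] (ρ L)) ω + ∑ l ∈ Finset.range L, a l * (lam l ^ i *
        (legendre l).eval ⟪n, (ω : EuclideanSpace ℝ (Fin 3))⟫_ℝ) := by
    intro L ω
    obtain ⟨C, hC⟩ := hρb L
    obtain ⟨C', hC'⟩ := exists_bound_comp_inner_sphere (hSc L) hn
    have hdec : κ = ρ L + (1:ℝ) • S L := by
      funext y
      simp only [hκ, hρ, hS, Pi.add_apply, Pi.smul_apply, smul_eq_mul, one_mul, sub_add_cancel]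
    rw [hdec, iterate_zonalOp_add_smul hK hk hM i (hρm L) (hSm L) hC hC' 1 ω (by simp), one_mul,
      iterate_zonalOp_legendreSum hK hk hM hn i a L ω (by simp)]
  -- Step 3: pairing with `Y`; the modes `ℓ = 0, 1` drop out
  have hPY : ∀ l, Integrable (fun ω : sphere (0 : EuclideanSpace ℝ (Fin 3)) 1 =>
      (legendre l).eval ⟪n, (ω : EuclideanSpace ℝ (Fin 3))⟫_ℝ * Y ω) sphereMeasure := fun l =>
    integrable_sphere_zonal_mul (k := fun t => (legendre l).eval t) hn
      ((legendre l).continuous.intervalIntegrable _ _) hY hm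
  have hP0 : ∫ ω : sphere (0 : EuclideanSpace ℝ (Fin 3)) 1,
      (legendre 0).eval ⟪n, (ω : EuclideanSpace ℝ (Fin 3))⟫_ℝ * Y ω ∂sphereMeasure = 0 := by
    simp [legendre_zero, h0]
  have hP1 : ∫ ω : sphere (0 : EuclideanSpace ℝ (Fin 3)) 1,
      (legendre 1).eval ⟪n, (ω : EuclideanSpace ℝ (Fin 3))⟫_ℝ * Y ω ∂sphereMeasure = 0 := by
    have h := integral_inner (𝕜 := ℝ) (integrable_smul_sphere (integrable_sphere_of_abs_le hY hm)) n
    simp_rw [inner_smul_right] at h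
    rw [h1, inner_zero_right] at h
    simpa [legendre_one, mul_comm] using h
  have step3 : ∀ N : ℕ, ∫ ω : sphere (0 : EuclideanSpace ℝ (Fin 3)) 1, (K^[i] κ) ω * Y ω ∂sphereMeasure =
      (∫ ω : sphere (0 : EuclideanSpace ℝ (Fin 3)) 1, (K^[i] (ρ (N + 2))) ω * Y ω ∂sphereMeasure) +
      ∑ l ∈ Finset.range N, a (l + 2) * lam (l + 2) ^ i *
        ∫ ω : sphere (0 : EuclideanSpace ℝ (Fin 3)) 1,
          (legendre (l + 2)).eval ⟪n, (ω : EuclideanSpace ℝ (Fin 3))⟫_ℝ * Y ω ∂sphereMeasure := by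
    intro N
    obtain ⟨C, hC⟩ := hKρb (N + 2)
    have hdist : ∀ ω : sphere (0 : EuclideanSpace ℝ (Fin 3)) 1, (K^[i] κ) ω * Y ω =
        (K^[i] (ρ (N + 2))) ω * Y ω + ∑ l ∈ Finset.range (N + 2), a l * lam l ^ i *
          ((legendre l).eval ⟪n, (ω : EuclideanSpace ℝ (Fin 3))⟫_ℝ * Y ω) := fun ω => by
      rw [step2 (N + 2) ω, add_mul, Finset.sum_mul]
      exact congrArg _ (Finset.sum_congr rfl fun l _ => by ring)
    have hYm : AEStronglyMeasurable (fun ω : sphere (0 : EuclideanSpace ℝ (Fin 3)) 1 => Y ω) sphereMeasure :=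
      (hY.comp continuous_subtype_val.measurable).aestronglyMeasurable
    have hI1 : Integrable (fun ω : sphere (0 : EuclideanSpace ℝ (Fin 3)) 1 => (K^[i] (ρ (N + 2))) ω * Y ω)
        sphereMeasure :=
      (integrable_sphere_of_abs_le (hKρm _) hC).mul_bdd hYm
        (Eventually.of_forall fun ω => by rw [Real.norm_eq_abs]; exact hm _ (by simp))
    have hI2 : Integrable (fun ω : sphere (0 : EuclideanSpace ℝ (Fin 3)) 1 =>
        ∑ l ∈ Finset.range (N + 2), a l * lam l ^ i *
          ((legendre l).eval ⟪n, (ω : EuclideanSpace ℝ (Fin 3))⟫_ℝ * Y ω)) sphereMeasure :=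
      integrable_finsetSum _ fun l _ => (hPY l).const_mul (a l * lam l ^ i)
    rw [integral_congr_ae (Eventually.of_forall hdist), integral_add hI1 hI2,
      integral_finsetSum _ fun l _ => (hPY l).const_mul (a l * lam l ^ i), Finset.sum_range_succ',
      Finset.sum_range_succ']
    simp only [integral_const_mul, zero_add, hP0, hP1, mul_zero, add_zero]
  -- Step 4: the estimate at level `N`
  have bound : ∀ N : ℕ, |(K^[i + 1] Y) n| ≤ m * ((4 * π * M) ^ i * (2 * π * I (N + 2))) + θ * m := by
    intro N
    obtain ⟨C, hC⟩ := hρb (N + 2)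
    obtain ⟨C', hC'⟩ := hKρb (N + 2)
    rw [step1, step3 N]
    refine (abs_add_le _ _).trans (add_le_add ?_ ?_)
    · have hrem : ∫ ω : sphere (0 : EuclideanSpace ℝ (Fin 3)) 1, |ρ (N + 2) ω| ∂sphereMeasure =
          2 * π * I (N + 2) :=
        integral_sphere_comp_inner_real hn (g := fun t => |k t - ∑ l ∈ Finset.range (N + 2),
          a l * (legendre l).eval t|)
          (continuous_abs.measurable.comp (hk.sub (hSc _).measurable)).aestronglyMeasurable
      calc |∫ ω : sphere (0 : EuclideanSpace ℝ (Fin 3)) 1, (K^[i] (ρ (N + 2))) ω * Y ω ∂sphereMeasure|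
          ≤ m * ∫ ω : sphere (0 : EuclideanSpace ℝ (Fin 3)) 1, |(K^[i] (ρ (N + 2))) ω| ∂sphereMeasure :=
            abs_integral_sphere_mul_le (hKρm _) hC' hm
        _ ≤ m * ((4 * π * M) ^ i * ∫ ω : sphere (0 : EuclideanSpace ℝ (Fin 3)) 1, |ρ (N + 2) ω| ∂sphereMeasure) :=
            mul_le_mul_of_nonneg_left (integral_abs_iterate_zonalOp_le hK hk hM i (hρm _) hC) hm0
        _ = _ := by rw [hrem]
    · calc |∑ l ∈ Finset.range N, a (l + 2) * lam (l + 2) ^ i *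
            ∫ ω : sphere (0 : EuclideanSpace ℝ (Fin 3)) 1,
              (legendre (l + 2)).eval ⟪n, (ω : EuclideanSpace ℝ (Fin 3))⟫_ℝ * Y ω ∂sphereMeasure|
          ≤ ∑ l ∈ Finset.range N, |a (l + 2) * lam (l + 2) ^ i *
            ∫ ω : sphere (0 : EuclideanSpace ℝ (Fin 3)) 1,
              (legendre (l + 2)).eval ⟪n, (ω : EuclideanSpace ℝ (Fin 3))⟫_ℝ * Y ω ∂sphereMeasure| :=
            Finset.abs_sum_le_sum_abs _ _
        _ ≤ ∑ l ∈ Finset.range N, (2 * ((l + 2 : ℕ) : ℝ) + 1) / 2 *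
            (∫ x in (-1:ℝ)..1, |(legendre (l + 2)).eval x|) * |lam (l + 2)| ^ (i + 1) * m := by
            refine Finset.sum_le_sum fun l _ => ?_
            have hPb := abs_integral_sphere_zonal_mul_le (k := fun t => (legendre (l + 2)).eval t) hn
              ((legendre (l + 2)).continuous.intervalIntegrable _ _) hm
            rw [abs_mul, abs_mul, abs_pow]
            refine (mul_le_mul_of_nonneg_left hPb (by positivity)).trans (le_of_eq ?_)
            have hal : |a (l + 2)| = (2 * ((l + 2 : ℕ) : ℝ) + 1) / 2 *
                |∫ z in (-1:ℝ)..1, k z * (legendre (l + 2)).eval z| := by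
              rw [ha]
              dsimp only
              rw [abs_mul, abs_of_pos (by positivity : (0:ℝ) < (2 * ((l + 2 : ℕ) : ℝ) + 1) / 2)]
            have hll : |lam (l + 2)| = 2 * π * |∫ z in (-1:ℝ)..1, k z * (legendre (l + 2)).eval z| := by
              rw [hlam]
              dsimp only
              rw [abs_mul, abs_of_pos (by positivity : (0:ℝ) < 2 * π)]
            rw [hal, hll]
            ring
        _ = (∑ l ∈ Finset.range N, (2 * ((l + 2 : ℕ) : ℝ) + 1) / 2 *
            (∫ x in (-1:ℝ)..1, |(legendre (l + 2)).eval x|) * |lam (l + 2)| ^ (i + 1)) * m := by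
            rw [Finset.sum_mul]
        _ ≤ θ * m := mul_le_mul_of_nonneg_right (hθ N) hm0
  -- Step 5: `N → ∞`
  have hlim : Tendsto (fun N : ℕ => m * ((4 * π * M) ^ i * (2 * π * I (N + 2))) + θ * m) atTop (𝓝 (θ * m)) := by
    have h := (((hIt.comp (tendsto_add_atTop_nat 2)).const_mul (2 * π)).const_mul
      ((4 * π * M) ^ i)).const_mul m |>.add_const (θ * m)
    simpa using h
  exact ge_of_tendsto' hlim bound

end Contraction

/-! ### Registered helpers -/

/-- **Registered helper `t12_iterate_zonal_contraction_sup` — the `ℓ ≥ 2` sup-norm contraction of an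
iterated zonal operator from its Legendre multipliers.** For a measurable zonal weight `k : ℝ → ℝ` with
`|k| ≤ M` on `[-1, 1]`, `j ≥ 1` and `θ` with `Σ_{ℓ=2}^{N+1} (2ℓ+1)/2 ‖P_ℓ‖_{L¹[-1,1]} |λ_ℓ|^j ≤ θ` for all `N`,
`λ_ℓ = 2π ∫_{-1}^{1} k P_ℓ` (the Funk–Hecke multipliers of `(K F)(x) = ∫_{S²} k(⟪x, ω⟫) F(ω) dσ(ω)`,
`t12_funkHecke_legendre`): every measurable profile `Y : ℝ³ → ℝ` with `|Y| ≤ m` on the unit sphere, ZERO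
ZONAL AVERAGE `∫ Y dσ = 0` and ZERO DIPOLE MOMENT `∫ Y(ω) ω dσ(ω) = 0` satisfies
`|(K^j Y)(n)| ≤ θ m` at every unit `n` — i.e. `‖K^j‖_{L^∞ → L^∞} ≤ θ` on the sector `ℓ ≥ 2` (plan §6 FF3/FF4:
"`θ_j ≤ Σ_{ℓ≥2} (2ℓ+1)/2 ‖P_ℓ‖₁ Π|P_ℓ(ρ_i)|`"). Ingredients: symmetry of `K` (Fubini), the Legendre
SERIES of `k` in `L²[-1, 1]` (`legendreBasis`, converging in `L¹`), `K^{j-1} P_ℓ(⟪n, ·⟫) = λ_ℓ^{j-1} P_ℓ(⟪n, ·⟫)`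
(`t12_iterate_zonal_legendre`), the `L¹(S²)` bound `(4πM)^{j-1}` of the iterates, and duality
(`t12_angularContraction`: the modes `ℓ = 0, 1` are annihilated by `Y`). [folklore] -/
theorem t12_iterate_zonal_contraction_sup : ∀ (k : ℝ → ℝ) (M : ℝ), Measurable k → (∀ t ∈ Set.Icc (-1 : ℝ) 1, |k t| ≤ M) → ∀ (j : ℕ) (θ : ℝ), 0 < j → (∀ N : ℕ, ∑ ℓ ∈ Finset.range N, (2 * ((ℓ + 2 : ℕ) : ℝ) + 1) / 2 * (∫ x in (-1 : ℝ)..1, |(Literature.Analysis.SpecialFunctions.legendre (ℓ + 2)).eval x|) * |2 * Real.pi * ∫ z in (-1 : ℝ)..1, k z * (Literature.Analysis.SpecialFunctions.legendre (ℓ + 2)).eval z| ^ j ≤ θ) → ∀ (Y : EuclideanSpace ℝ (Fin 3) → ℝ) (m : ℝ), Measurable Y → (∀ x : EuclideanSpace ℝ (Fin 3), ‖x‖ = 1 → |Y x| ≤ m) → ∫ ω : Metric.sphere (0 : EuclideanSpace ℝ (Fin 3)) 1, Y (ω : EuclideanSpace ℝ (Fin 3)) ∂Literature.MathematicalPhysics.KineticTheory.sphereMeasure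 = 0 → ∫ ω : Metric.sphere (0 : EuclideanSpace ℝ (Fin 3)) 1, Y (ω : EuclideanSpace ℝ (Fin 3)) • (ω : EuclideanSpace ℝ (Fin 3)) ∂Literature.MathematicalPhysics.KineticTheory.sphereMeasure = 0 → ∀ n : EuclideanSpace ℝ (Fin 3), ‖n‖ = 1 → |Nat.iterate (fun (F : EuclideanSpace ℝ (Fin 3) → ℝ) (x : EuclideanSpace ℝ (Fin 3)) => ∫ ω : Metric.sphere (0 : EuclideanSpace ℝ (Fin 3)) 1, k (inner ℝ x (ω : EuclideanSpace ℝ (Fin 3))) * F (ω : EuclideanSpace ℝ (Fin 3)) ∂Literature.MathematicalPhysics.KineticTheory.sphereMeasure) j Y n| ≤ θ * m :=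
  fun _ _ hk hM _ _ hj hθ _ _ hY hm h0 h1 _ hn =>
    abs_iterate_zonalOp_le_of_orthogonal rfl hk hM hj hθ hY hm h0 h1 hn

/-- **Registered helper `t12_farField_contraction_sup` — EIGHT normalised far-field steps contract the
sector `ℓ ≥ 2` of `L^∞(S²)` by `2/3`.** Let `T` be the normalised far-field step on the linear-growth
class, the zonal operator `(T F)(x) = ∫_{S²} (2/π) ⟪x, ω⟫₊² F(ω) dσ(ω)` (`σ` the surface measure of `S²`,
mass `4π`; `lorentzGain u (s n) = πs · s · (T Y)(n)` for `u(r x) = r Y(x)`,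
`lorentzGain_smul_of_linear_eq_farFieldStep`; Legendre multipliers `λ_ℓ = 4∫₀¹ ρ² P_ℓ(ρ) dρ = 4/3, 1, 8/15, …`,
`farFieldStep_legendreCoeff` — the plan's `λ_ℓ(1)`, so NO further normalisation enters). Then for every
measurable profile `Y : ℝ³ → ℝ` with `|Y| ≤ m` on the unit sphere, `∫ Y dσ = 0` and `∫ Y(ω) ω dσ(ω) = 0`:
`|(T⁸ Y)(n)| ≤ (2/3) m` at every unit `n` — the certified number `θ₈ ≤ Σ_{ℓ≥2} c_ℓ μ_ℓ⁸ ≤ 2/3` of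
`t12_farField_legendreCertificate` (`|λ_ℓ| ≤ μ_ℓ`, `abs_farFieldStep_legendreCoeff_le`) fed into
`t12_iterate_zonal_contraction_sup`. This is the `ℓ ≥ 2` engine of plan §6 (FF2+FF3+FF4) of the
registered sub-goal `t12_logLinearPreimage_and_dipoleModulus`. [folklore] -/
theorem t12_farField_contraction_sup : ∀ (Y : EuclideanSpace ℝ (Fin 3) → ℝ) (m : ℝ), Measurable Y → (∀ x : EuclideanSpace ℝ (Fin 3), ‖x‖ = 1 → |Y x| ≤ m) → ∫ ω : Metric.sphere (0 : EuclideanSpace ℝ (Fin 3)) 1, Y (ω : EuclideanSpace ℝ (Fin 3)) ∂Literature.MathematicalPhysics.KineticTheory.sphereMeasure = 0 → ∫ ω : Metric.sphere (0 : EuclideanSpace ℝ (Fin 3)) 1, Y (ω : EuclideanSpace ℝ (Fin 3)) • (ω : EuclideanSpace ℝ (Fin 3)) ∂Literature.MathematicalPhysics.KineticTheory.sphereMeasure = 0 → ∀ n : EuclideanSpace ℝ (Fin 3), ‖n‖ = 1 → |Nat.iterate (fun (F : EuclideanSpace ℝ (Fin 3) → ℝ) (x : EuclideanSpace ℝ (Fin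 3)) => ∫ ω : Metric.sphere (0 : EuclideanSpace ℝ (Fin 3)) 1, 2 / Real.pi * max (inner ℝ x (ω : EuclideanSpace ℝ (Fin 3))) 0 ^ 2 * F (ω : EuclideanSpace ℝ (Fin 3)) ∂Literature.MathematicalPhysics.KineticTheory.sphereMeasure) 8 Y n| ≤ 2 / 3 * m := by
  intro Y m hY hm h0 h1 n hn
  have hk : Measurable fun t : ℝ => 2 / π * max t 0 ^ 2 :=
    measurable_const.mul ((measurable_id.max measurable_const).pow_const 2)
  have hM : ∀ t ∈ Icc (-1:ℝ) 1, |2 / π * max t 0 ^ 2| ≤ 2 / π := by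
    intro t ht
    rw [abs_mul, abs_of_pos (by positivity : (0:ℝ) < 2 / π), abs_pow, abs_of_nonneg (le_max_right _ _)]
    refine mul_le_of_le_one_right (by positivity) ?_
    have h1 : max t 0 ≤ 1 := max_le ht.2 zero_le_one
    nlinarith [le_max_right t 0]
  have hθ : ∀ N : ℕ, ∑ l ∈ Finset.range N, (2 * ((l + 2 : ℕ) : ℝ) + 1) / 2 *
      (∫ x in (-1:ℝ)..1, |(legendre (l + 2)).eval x|) *
      |2 * π * ∫ z in (-1:ℝ)..1, 2 / π * max z 0 ^ 2 * (legendre (l + 2)).eval z| ^ 8 ≤ 2 / 3 := by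
    intro N
    refine (Finset.sum_le_sum fun l _ => ?_).trans (t12_farField_legendreCertificate N)
    exact mul_le_mul_of_nonneg_left (pow_le_pow_left₀ (abs_nonneg _) (abs_farFieldStep_legendreCoeff_le _) 8)
      (mul_nonneg (by positivity) (integral_abs_legendre_nonneg _))
  exact abs_iterate_zonalOp_le_of_orthogonal (k := fun t : ℝ => 2 / π * max t 0 ^ 2) rfl hk hM
    (by norm_num) hθ hY hm h0 h1 hn

/-- **Six steps contract by `1/2`**: the same with the sharper certificate `Σ_{ℓ≥2} c_ℓ μ_ℓ⁶ ≤ 1/2` of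
`farField_legendreCertificate_six`: `|(T⁶ Y)(n)| ≤ m/2` on the sector `ℓ ≥ 2`. [folklore] -/
theorem farField_contraction_sup_six {Y : EuclideanSpace ℝ (Fin 3) → ℝ} (hY : Measurable Y) {m : ℝ}
    (hm : ∀ x : EuclideanSpace ℝ (Fin 3), ‖x‖ = 1 → |Y x| ≤ m)
    (h0 : ∫ ω : sphere (0 : EuclideanSpace ℝ (Fin 3)) 1, Y ω ∂sphereMeasure = 0)
    (h1 : ∫ ω : sphere (0 : EuclideanSpace ℝ (Fin 3)) 1, Y ω • (ω : EuclideanSpace ℝ (Fin 3)) ∂sphereMeasure = 0)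
    {n : EuclideanSpace ℝ (Fin 3)} (hn : ‖n‖ = 1) :
    |((fun (F : EuclideanSpace ℝ (Fin 3) → ℝ) (x : EuclideanSpace ℝ (Fin 3)) =>
        ∫ ω : sphere (0 : EuclideanSpace ℝ (Fin 3)) 1,
          2 / π * max ⟪x, (ω : EuclideanSpace ℝ (Fin 3))⟫_ℝ 0 ^ 2 * F ω ∂sphereMeasure)^[6] Y) n| ≤ 1 / 2 * m := by
  have hk : Measurable fun t : ℝ => 2 / π * max t 0 ^ 2 :=
    measurable_const.mul ((measurable_id.max measurable_const).pow_const 2)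
  have hM : ∀ t ∈ Icc (-1:ℝ) 1, |2 / π * max t 0 ^ 2| ≤ 2 / π := by
    intro t ht
    rw [abs_mul, abs_of_pos (by positivity : (0:ℝ) < 2 / π), abs_pow, abs_of_nonneg (le_max_right _ _)]
    refine mul_le_of_le_one_right (by positivity) ?_
    have h1 : max t 0 ≤ 1 := max_le ht.2 zero_le_one
    nlinarith [le_max_right t 0]
  have hθ : ∀ N : ℕ, ∑ l ∈ Finset.range N, (2 * ((l + 2 : ℕ) : ℝ) + 1) / 2 *
      (∫ x in (-1:ℝ)..1, |(legendre (l + 2)).eval x|) *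
      |2 * π * ∫ z in (-1:ℝ)..1, 2 / π * max z 0 ^ 2 * (legendre (l + 2)).eval z| ^ 6 ≤ 1 / 2 := by
    intro N
    refine (Finset.sum_le_sum fun l _ => ?_).trans (farField_legendreCertificate_six N)
    exact mul_le_mul_of_nonneg_left (pow_le_pow_left₀ (abs_nonneg _) (abs_farFieldStep_legendreCoeff_le _) 6)
      (mul_nonneg (by positivity) (integral_abs_legendre_nonneg _))
  exact abs_iterate_zonalOp_le_of_orthogonal (k := fun t : ℝ => 2 / π * max t 0 ^ 2) rfl hk hM
    (by norm_num) hθ hY hm h0 h1 hn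

end Summit.AtomisticToContinuum.HydrodynamicLimit.Theorems.ClampedCorrectorBirth

end
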